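import Summits.AtomisticToContinuum.BoseEinsteinCondensation.Theorems.BECInsertionCorrectorCorrectorClosureTailModesAux
import Literature.MathematicalPhysics.QuantumManyBody.InsertionStateIdentities
import HarnessLib

/-!
# Crux `CorrectorClosure` (stmt-AtomisticToContinuum-12058), line `healing-scale-kac-insertion` —
registered sub-goal `hMinusOneSqW_tail_modes_le` of the heart `stub_kacClosure`

Supports (does not close) stmt-AtomisticToContinuum-12058, route `BECInsertionCorrector`: the
SOURCE HALF of the route's `FirstCorrectorBounds`, in the weighted-corrector vocabulary of
`Literature/MathematicalPhysics/QuantumManyBody/WeightedCorrector.lean`.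

**Statement.** On the `(N+1)`-particle torus of side `L > 0` take the PRODUCT weight
`F(y, X') = Θ(X')` (`y = X 0` the tagged coordinate, `X' = vecTail X` the bath, `Θ` continuous) and
the source `s(X) = ∑_{m ∈ S} (a_m(X') cos(p_m·y) + b_m(X') sin(p_m·y))`, `p_m = 2πm/L`, a finite
family of tagged-coordinate Fourier modes with continuous bath coefficients, `S ⊂ ℤ³` containing
no antipodal pair (`m ∈ S ⇒ -m ∉ S`, whence `0 ∉ S`). Then
`‖s‖²_{H₋₁(F)} ≤ (L³/2) ∑_{m ∈ S} (‖a_m‖²_{H₋₁(Θ)} + ‖b_m‖²_{H₋₁(Θ)})`, uniformly in `N`.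

**Proof.** Bound every term of the variational supremum defining `‖s‖²₋₁`. For a periodic test
`φ` on `Config (N+1)` put `A_m(X') = ∫_{[0,L)³} cos(p_m·y) φ(y, X') dy`, `B_m` with `sin`
(UNNORMALISED mode coefficients; `κ = 2/L³`).
1. `A_m, B_m` are periodic test functions on `Config N` with
   `∂_{j,k} A_m(X') = ∫ cos(p_m·y) ∂_{j+1,k}φ(y, X') dy` (file `…TailModesAux`).
2. Pairing (Fubini `cellN (N+1) L ≅ cell L × cellN N L` along the tagged particle):
   `∫ s φ F² = ∑_m (∫ a_m A_m Θ² + ∫ b_m B_m Θ²)`.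
3. Dirichlet form: drop the tagged particle's own gradient and apply Bessel's inequality in
   `L²([0,L)³, dy)` to the finite orthogonal family `{cos(p_m·), sin(p_m·)}_{m ∈ S}` (pairwise
   orthogonal, squared norms `L³/2`; here the antipodal condition enters), slice by slice:
   `𝓔_F(φ, φ) ≥ κ ∑_m (𝓔_Θ(A_m, A_m) + 𝓔_Θ(B_m, B_m))` (`dirichletFormW_modeCoeff_le`).
4. Hence `2∫ s φ F² - 𝓔_F(φ,φ) ≤ (L³/2) ∑_m (T(a_m, κA_m) + T(b_m, κB_m))`,
   `T(g, ψ) = 2∫ g ψ Θ² - 𝓔_Θ(ψ, ψ) ≤ ‖g‖²₋₁` (`le_hMinusOneSqW`); pass to `ℝ≥0∞`.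
-/

noncomputable section

open MeasureTheory Matrix
open scoped ENNReal NNReal BigOperators

namespace Summit.AtomisticToContinuum.BoseEinsteinCondensation.Theorems.CorrectorClosure.HealingScaleKacInsertion

open Literature.MathematicalPhysics.QuantumManyBody.BoseGas

variable {N : ℕ} {L : ℝ}

/-! ### Splitting off the tagged particle: pairing and Dirichlet form -/

/-- `vecTail : (ℝ³)^{N+1} → (ℝ³)^N` is continuous. [folklore] -/
theorem continuous_vecTail_config : Continuous (Matrix.vecTail : Config (N + 1) → Config N) :=
  continuous_pi fun j => continuous_apply j.succ

/-- **Pairing along the tagged particle** (Fubini `[0,L)^{3(N+1)} ≅ [0,L)³ × [0,L)^{3N}`):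
`∫ g(X') w(y) φ(y, X') Θ(X')² dX = ∫ g(X') (∫ w(y) φ(y, X') dy) Θ(X')² dX'` for continuous data.
[folklore] -/
theorem setIntegral_cellN_succ_taggedMode {Θ g : Config N → ℝ} (hΘ : Continuous Θ)
    (hg : Continuous g) {w : Space → ℝ} (hw : Continuous w) {φ : Config (N + 1) → ℝ}
    (hφ : Continuous φ) :
    ∫ X in cellN (N + 1) L, g (Matrix.vecTail X) * w (X 0) * φ X * Θ (Matrix.vecTail X) ^ 2 =
      ∫ Z in cellN N L, g Z * (∫ y in cell L, w y * φ (Matrix.vecCons y Z)) * Θ Z ^ 2 := by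
  have ht := continuous_vecTail_config (N := N)
  have hc : Continuous fun X : Config (N + 1) =>
      g (Matrix.vecTail X) * w (X 0) * φ X * Θ (Matrix.vecTail X) ^ 2 :=
    (((hg.comp ht).mul (hw.comp (continuous_apply 0))).mul hφ).mul ((hΘ.comp ht).pow 2)
  rw [setIntegral_cellN_succ_right_of_continuous hc]
  refine integral_congr_ae (Filter.Eventually.of_forall fun Z => ?_)
  simp only [Matrix.tail_cons, Matrix.cons_val_zero]
  have hpt : ∀ y : Space, g Z * w y * φ (Matrix.vecCons y Z) * Θ Z ^ 2 =
      g Z * Θ Z ^ 2 * (w y * φ (Matrix.vecCons y Z)) := fun y => by ring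
  simp_rw [hpt]
  rw [integral_const_mul]
  ring

/-- **The bath Dirichlet forms of the mode coefficients are dominated by the full Dirichlet form**
(product weight `F(y, X') = Θ(X')`): with `A_m(X') = ∫ cos(p_m·y) φ(y, X') dy`,
`B_m(X') = ∫ sin(p_m·y) φ(y, X') dy` over a set `S` of frequencies without antipodal pairs,
`(2/L³) ∑_{m ∈ S} (𝓔_Θ(A_m, A_m) + 𝓔_Θ(B_m, B_m)) ≤ 𝓔_F(φ, φ)` — drop the tagged gradient, Fubini,
and Bessel in `L²([0,L)³, dy)` slice by slice, using `∂_{j,k} A_m = ∫ cos(p_m·y) ∂_{j+1,k}φ dy`.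
[folklore] -/
theorem dirichletFormW_modeCoeff_le (hL : 0 < L) {Θ : Config N → ℝ} (hΘ : Continuous Θ)
    {S : Finset (Fin 3 → ℤ)} (hS : ∀ m ∈ S, -m ∉ S) {φ : Config (N + 1) → ℝ}
    (hφ : IsPeriodicTest L φ) (A B : (Fin 3 → ℤ) → Config N → ℝ)
    (hA : ∀ m Z, A m Z = ∫ y in cell L,
      Real.cos (2 * Real.pi / L * ∑ i, (m i : ℝ) * y i) * φ (Matrix.vecCons y Z))
    (hB : ∀ m Z, B m Z = ∫ y in cell L,
      Real.sin (2 * Real.pi / L * ∑ i, (m i : ℝ) * y i) * φ (Matrix.vecCons y Z)) :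
    2 / L ^ 3 * ∑ m ∈ S, (dirichletFormW L Θ (A m) (A m) + dirichletFormW L Θ (B m) (B m)) ≤
      dirichletFormW L (fun X : Config (N + 1) => Θ (Matrix.vecTail X)) φ φ := by
  have hφ1 : ContDiff ℝ 1 φ := hφ.contDiff
  have ht := continuous_vecTail_config (N := N)
  -- the mode coefficients as periodic test functions, and their derivatives
  have hAf : ∀ m, A m = fun Z => ∫ y in cell L,
      Real.cos (2 * Real.pi / L * ∑ i, (m i : ℝ) * y i) * φ (Matrix.vecCons y Z) :=
    fun m => funext (hA m)
  have hBf : ∀ m, B m = fun Z => ∫ y in cell L,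
      Real.sin (2 * Real.pi / L * ∑ i, (m i : ℝ) * y i) * φ (Matrix.vecCons y Z) :=
    fun m => funext (hB m)
  have hAt : ∀ m, IsPeriodicTest L (A m) := fun m => by
    rw [hAf m]; exact isPeriodicTest_modeCoeff hL hφ (continuous_cos_modePhase L m)
  have hBt : ∀ m, IsPeriodicTest L (B m) := fun m => by
    rw [hBf m]; exact isPeriodicTest_modeCoeff hL hφ (continuous_sin_modePhase L m)
  have hAd : ∀ m Z j k, pderiv j k (A m) Z = ∫ y in cell L,
      Real.cos (2 * Real.pi / L * ∑ i, (m i : ℝ) * y i) * pderiv j.succ k φ (Matrix.vecCons y Z) :=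
    fun m Z j k => by rw [hAf m]; exact pderiv_modeCoeff hL hφ (continuous_cos_modePhase L m) Z j k
  have hBd : ∀ m Z j k, pderiv j k (B m) Z = ∫ y in cell L,
      Real.sin (2 * Real.pi / L * ∑ i, (m i : ℝ) * y i) * pderiv j.succ k φ (Matrix.vecCons y Z) :=
    fun m Z j k => by rw [hBf m]; exact pderiv_modeCoeff hL hφ (continuous_sin_modePhase L m) Z j k
  -- constants
  have hL3 : 0 < L ^ 3 / 2 := by positivity
  have hκ : 2 / L ^ 3 * (L ^ 3 / 2) = 1 := by field_simp
  have hκ0 : 0 ≤ 2 / L ^ 3 := by positivity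
  -- Step 1: Bessel on every slice, for every bath derivative `∂_{j+1,k}`
  have hbessel : ∀ (Z : Config N) (j : Fin N) (k : Fin 3),
      ∑ m ∈ S, (pderiv j k (A m) Z ^ 2 + pderiv j k (B m) Z ^ 2) ≤
        L ^ 3 / 2 * ∫ y in cell L, pderiv j.succ k φ (Matrix.vecCons y Z) ^ 2 := by
    intro Z j k
    have hf : Continuous fun y : Space => pderiv j.succ k φ (Matrix.vecCons y Z) :=
      (continuous_pderiv hφ1 _ _).comp (continuous_id.matrixVecCons continuous_const)
    have key := sum_sq_integral_mul_le_of_orthogonal (L := L) (S.disjSum S)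
      (e := Sum.elim (fun m y => Real.cos (2 * Real.pi / L * ∑ i, (m i : ℝ) * y i))
        (fun m y => Real.sin (2 * Real.pi / L * ∑ i, (m i : ℝ) * y i)))
      (f := fun y : Space => pderiv j.succ k φ (Matrix.vecCons y Z)) ?_ hf hL3 ?_
    · rw [Finset.sum_disjSum] at key
      simp only [Sum.elim_inl, Sum.elim_inr] at key
      rw [Finset.sum_add_distrib]
      simp only [hAd, hBd]
      exact key
    · rintro (m | m) hm
      · exact continuous_cos_modePhase L m
      · exact continuous_sin_modePhase L m
    · rintro (m | m) hm (m' | m') hm'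
      · rw [Finset.inl_mem_disjSum] at hm hm'
        simp only [Sum.elim_inl, Sum.inl.injEq]
        exact integral_cell_cos_mul_cos hL hS hm hm'
      · simp only [Sum.elim_inl, Sum.elim_inr, reduceCtorEq, if_false]
        exact integral_cell_cos_mul_sin hL m m'
      · simp only [Sum.elim_inl, Sum.elim_inr, reduceCtorEq, if_false]
        rw [← integral_cell_cos_mul_sin hL m' m]
        exact integral_congr_ae (Filter.Eventually.of_forall fun y => mul_comm _ _)
      · rw [Finset.inr_mem_disjSum] at hm hm'
        simp only [Sum.elim_inr, Sum.inr.injEq]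
        exact integral_cell_sin_mul_sin hL hS hm hm'
  -- Step 2: the bath part `G` of the gradient of `φ`, and `∫ G ≤ 𝓔_F(φ, φ)`
  have hGc : Continuous fun X : Config (N + 1) =>
      (∑ j : Fin N, ∑ k : Fin 3, pderiv j.succ k φ X ^ 2) * Θ (Matrix.vecTail X) ^ 2 :=
    (continuous_finsetSum _ fun j _ => continuous_finsetSum _ fun k _ =>
      (continuous_pderiv hφ1 _ _).pow 2).mul ((hΘ.comp ht).pow 2)
  have h1 : ∫ X in cellN (N + 1) L,
      (∑ j : Fin N, ∑ k : Fin 3, pderiv j.succ k φ X ^ 2) * Θ (Matrix.vecTail X) ^ 2 ≤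
        dirichletFormW L (fun X : Config (N + 1) => Θ (Matrix.vecTail X)) φ φ := by
    unfold dirichletFormW
    refine setIntegral_mono (integrableOn_cellN hGc L)
      (integrableOn_gradDot_mul_sq (hΘ.comp ht) hφ1 hφ1 L) fun X => ?_
    refine mul_le_mul_of_nonneg_right ?_ (sq_nonneg _)
    rw [gradDot, Fin.sum_univ_succ]
    simp only [sq]
    exact le_add_of_nonneg_left (Finset.sum_nonneg fun k _ => mul_self_nonneg _)
  -- Step 3: Fubini for `G`, and the inner integral
  have h2 := setIntegral_cellN_succ_right_of_continuous (L := L) hGc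
  have h3 : ∀ Z : Config N, ∫ y in cell L,
      (∑ j : Fin N, ∑ k : Fin 3, pderiv j.succ k φ (Matrix.vecCons y Z) ^ 2) *
        Θ (Matrix.vecTail (Matrix.vecCons y Z)) ^ 2 =
      (∑ j : Fin N, ∑ k : Fin 3, ∫ y in cell L, pderiv j.succ k φ (Matrix.vecCons y Z) ^ 2) *
        Θ Z ^ 2 := by
    intro Z
    simp only [Matrix.tail_cons]
    rw [integral_mul_const]
    congr 1
    have hjk : ∀ (j : Fin N) (k : Fin 3), Integrable
        (fun y : Space => pderiv j.succ k φ (Matrix.vecCons y Z) ^ 2) (volume.restrict (cell L)) :=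
      fun j k => integrableOn_cell
        (((continuous_pderiv hφ1 _ _).comp (continuous_id.matrixVecCons continuous_const)).pow 2)
    rw [integral_finsetSum _ fun j _ => integrable_finsetSum _ fun k _ => hjk j k]
    exact Finset.sum_congr rfl fun j _ => integral_finsetSum _ fun k _ => hjk j k
  -- Step 4: the pointwise (in `X'`) lower bound from Bessel
  have h4 : ∀ Z : Config N,
      2 / L ^ 3 * (∑ m ∈ S, (gradDot (A m) (A m) Z + gradDot (B m) (B m) Z)) * Θ Z ^ 2 ≤
        (∑ j : Fin N, ∑ k : Fin 3, ∫ y in cell L, pderiv j.succ k φ (Matrix.vecCons y Z) ^ 2) *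
          Θ Z ^ 2 := by
    intro Z
    refine mul_le_mul_of_nonneg_right ?_ (sq_nonneg _)
    have hswap : ∑ m ∈ S, (gradDot (A m) (A m) Z + gradDot (B m) (B m) Z) =
        ∑ j : Fin N, ∑ k : Fin 3, ∑ m ∈ S, (pderiv j k (A m) Z ^ 2 + pderiv j k (B m) Z ^ 2) := by
      simp only [gradDot, ← Finset.sum_add_distrib, sq]
      rw [Finset.sum_comm]
      exact Finset.sum_congr rfl fun j _ => Finset.sum_comm
    rw [hswap, Finset.mul_sum]
    refine Finset.sum_le_sum fun j _ => ?_
    rw [Finset.mul_sum]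
    refine Finset.sum_le_sum fun k _ => ?_
    calc 2 / L ^ 3 * ∑ m ∈ S, (pderiv j k (A m) Z ^ 2 + pderiv j k (B m) Z ^ 2)
        ≤ 2 / L ^ 3 * (L ^ 3 / 2 * ∫ y in cell L, pderiv j.succ k φ (Matrix.vecCons y Z) ^ 2) :=
          mul_le_mul_of_nonneg_left (hbessel Z j k) hκ0
      _ = ∫ y in cell L, pderiv j.succ k φ (Matrix.vecCons y Z) ^ 2 := by
          rw [← mul_assoc, hκ, one_mul]
  -- Step 5: integrate Step 4 over the bath cell
  have hAB : ∀ m, IntegrableOn (fun Z => gradDot (A m) (A m) Z * Θ Z ^ 2) (cellN N L) volume ∧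
      IntegrableOn (fun Z => gradDot (B m) (B m) Z * Θ Z ^ 2) (cellN N L) volume := fun m =>
    ⟨integrableOn_gradDot_mul_sq hΘ (hAt m).1 (hAt m).1 L,
      integrableOn_gradDot_mul_sq hΘ (hBt m).1 (hBt m).1 L⟩
  have hlc : Continuous fun Z : Config N =>
      2 / L ^ 3 * (∑ m ∈ S, (gradDot (A m) (A m) Z + gradDot (B m) (B m) Z)) * Θ Z ^ 2 :=
    (continuous_const.mul (continuous_finsetSum _ fun m _ =>
      (continuous_gradDot (hAt m).1 (hAt m).1).add (continuous_gradDot (hBt m).1 (hBt m).1))).mul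
      (hΘ.pow 2)
  have hri : IntegrableOn (fun Z : Config N =>
      (∑ j : Fin N, ∑ k : Fin 3, ∫ y in cell L, pderiv j.succ k φ (Matrix.vecCons y Z) ^ 2) *
        Θ Z ^ 2) (cellN N L) volume := by
    have hi := (integrable_comp_vecCons_prod_restrict (L := L) hGc).integral_prod_right
    refine hi.congr (Filter.Eventually.of_forall fun Z => ?_)
    exact h3 Z
  have h5 := setIntegral_mono (integrableOn_cellN hlc L) hri fun Z => h4 Z
  -- Step 6: evaluate the left-hand side of Step 5
  have h6 : ∫ Z in cellN N L,
      2 / L ^ 3 * (∑ m ∈ S, (gradDot (A m) (A m) Z + gradDot (B m) (B m) Z)) * Θ Z ^ 2 =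
        2 / L ^ 3 * ∑ m ∈ S, (dirichletFormW L Θ (A m) (A m) + dirichletFormW L Θ (B m) (B m)) := by
    have hpt : ∀ Z, 2 / L ^ 3 * (∑ m ∈ S, (gradDot (A m) (A m) Z + gradDot (B m) (B m) Z)) *
        Θ Z ^ 2 = 2 / L ^ 3 * ∑ m ∈ S,
          (gradDot (A m) (A m) Z * Θ Z ^ 2 + gradDot (B m) (B m) Z * Θ Z ^ 2) := fun Z => by
      rw [mul_assoc, Finset.sum_mul]
      congr 1
      exact Finset.sum_congr rfl fun m _ => by ring
    simp_rw [hpt]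
    rw [integral_const_mul, integral_finsetSum]
    · congr 1
      refine Finset.sum_congr rfl fun m _ => ?_
      rw [integral_add (hAB m).1 (hAB m).2]
      rfl
    · intro m _
      exact (hAB m).1.add (hAB m).2
  -- conclusion
  calc 2 / L ^ 3 * ∑ m ∈ S, (dirichletFormW L Θ (A m) (A m) + dirichletFormW L Θ (B m) (B m))
      = ∫ Z in cellN N L, 2 / L ^ 3 *
          (∑ m ∈ S, (gradDot (A m) (A m) Z + gradDot (B m) (B m) Z)) * Θ Z ^ 2 := h6.symm
    _ ≤ ∫ Z in cellN N L, (∑ j : Fin N, ∑ k : Fin 3,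
          ∫ y in cell L, pderiv j.succ k φ (Matrix.vecCons y Z) ^ 2) * Θ Z ^ 2 := h5
    _ = ∫ Z in cellN N L, ∫ y in cell L,
          (∑ j : Fin N, ∑ k : Fin 3, pderiv j.succ k φ (Matrix.vecCons y Z) ^ 2) *
            Θ (Matrix.vecTail (Matrix.vecCons y Z)) ^ 2 :=
        integral_congr_ae (Filter.Eventually.of_forall fun Z => (h3 Z).symm)
    _ = ∫ X in cellN (N + 1) L,
          (∑ j : Fin N, ∑ k : Fin 3, pderiv j.succ k φ X ^ 2) * Θ (Matrix.vecTail X) ^ 2 := h2.symm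
    _ ≤ dirichletFormW L (fun X : Config (N + 1) => Θ (Matrix.vecTail X)) φ φ := h1

/-! ### The `H₋₁` bound for a finite family of tagged-coordinate modes -/

/-- Bounding every term of the variational supremum bounds the `H₋₁` norm. [folklore] -/
theorem hMinusOneSqW_le_of_forall_test {M : ℕ} {L : ℝ} {F g : Config M → ℝ} {C : ℝ≥0∞}
    (h : ∀ φ : Config M → ℝ, IsPeriodicTest L φ →
      ENNReal.ofReal (2 * (∫ X in cellN M L, g X * φ X * F X ^ 2) - dirichletFormW L F φ φ) ≤ C) :
    hMinusOneSqW L F g ≤ C := by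
  unfold hMinusOneSqW
  exact iSup₂_le h

/-- **Registered sub-goal `hMinusOneSqW_tail_modes_le` of the heart `stub_kacClosure` (source half
of the route's `FirstCorrectorBounds`).** On the `(N+1)`-particle torus of side `L > 0` with the
product weight `F(y, X') = Θ(X')` (`y = X 0`, `X' = vecTail X`, `Θ` continuous), the Kipnis–Varadhan
`H₋₁` norm of a finite family of tagged-coordinate Fourier modes
`s = ∑_{m ∈ S} (a_m(X') cos(p_m·y) + b_m(X') sin(p_m·y))`, `p_m = 2πm/L`, `S` without antipodal
pairs, with continuous bath coefficients, is at most `(L³/2) ∑_{m ∈ S} (‖a_m‖²₋₁ + ‖b_m‖²₋₁)`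
(bath norms for the weight `Θ`), uniformly in `N`: the modes are orthogonal in `y`. Proof in the
module docstring (mode coefficients of the test function, Fubini, Bessel, `le_hMinusOneSqW`).
[folklore] -/
theorem hMinusOneSqW_tail_modes_le (N : ℕ) (L : ℝ) (hL : 0 < L) (Θ : Config N → ℝ)
    (hΘ : Continuous Θ) (S : Finset (Fin 3 → ℤ)) (_hS0 : (0 : Fin 3 → ℤ) ∉ S)
    (hS : ∀ m ∈ S, -m ∉ S) (a b : (Fin 3 → ℤ) → Config N → ℝ)
    (ha : ∀ m ∈ S, Continuous (a m)) (hb : ∀ m ∈ S, Continuous (b m)) :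
    hMinusOneSqW L (fun X : Config (N + 1) => Θ (vecTail X))
        (fun X : Config (N + 1) => ∑ m ∈ S,
          (a m (vecTail X) * Real.cos (2 * Real.pi / L * ∑ i, (m i : ℝ) * X 0 i) +
            b m (vecTail X) * Real.sin (2 * Real.pi / L * ∑ i, (m i : ℝ) * X 0 i))) ≤
      ENNReal.ofReal (L ^ 3 / 2) * ∑ m ∈ S, (hMinusOneSqW L Θ (a m) + hMinusOneSqW L Θ (b m)) := by
  -- `0 ∉ S` (binder `_hS0`) is implied by the antipodal condition (`m = 0 = -m`) and not used.
  refine hMinusOneSqW_le_of_forall_test fun φ hφ => ?_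
  -- the (unnormalised) mode coefficients of the test function
  obtain ⟨A, hA⟩ : ∃ A : (Fin 3 → ℤ) → Config N → ℝ, ∀ m Z, A m Z = ∫ y in cell L,
      Real.cos (2 * Real.pi / L * ∑ i, (m i : ℝ) * y i) * φ (Matrix.vecCons y Z) :=
    ⟨fun m Z => ∫ y in cell L,
      Real.cos (2 * Real.pi / L * ∑ i, (m i : ℝ) * y i) * φ (Matrix.vecCons y Z), fun _ _ => rfl⟩
  obtain ⟨B, hB⟩ : ∃ B : (Fin 3 → ℤ) → Config N → ℝ, ∀ m Z, B m Z = ∫ y in cell L,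
      Real.sin (2 * Real.pi / L * ∑ i, (m i : ℝ) * y i) * φ (Matrix.vecCons y Z) :=
    ⟨fun m Z => ∫ y in cell L,
      Real.sin (2 * Real.pi / L * ∑ i, (m i : ℝ) * y i) * φ (Matrix.vecCons y Z), fun _ _ => rfl⟩
  have hAt : ∀ m, IsPeriodicTest L (A m) := fun m => by
    rw [show A m = _ from funext (hA m)]
    exact isPeriodicTest_modeCoeff hL hφ (continuous_cos_modePhase L m)
  have hBt : ∀ m, IsPeriodicTest L (B m) := fun m => by
    rw [show B m = _ from funext (hB m)]
    exact isPeriodicTest_modeCoeff hL hφ (continuous_sin_modePhase L m)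
  have ht := continuous_vecTail_config (N := N)
  have hφc : Continuous φ := hφ.continuous
  -- Step 1: the pairing, mode by mode (Fubini along the tagged particle)
  have hI : ∀ m ∈ S, IntegrableOn (fun X : Config (N + 1) => a m (vecTail X) *
        Real.cos (2 * Real.pi / L * ∑ i, (m i : ℝ) * X 0 i) * φ X * Θ (vecTail X) ^ 2)
        (cellN (N + 1) L) volume ∧
      IntegrableOn (fun X : Config (N + 1) => b m (vecTail X) *
        Real.sin (2 * Real.pi / L * ∑ i, (m i : ℝ) * X 0 i) * φ X * Θ (vecTail X) ^ 2)
        (cellN (N + 1) L) volume := fun m hm =>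
    ⟨integrableOn_cellN (((((ha m hm).comp ht).mul
        ((continuous_cos_modePhase L m).comp (continuous_apply 0))).mul hφc).mul
        ((hΘ.comp ht).pow 2)) L,
      integrableOn_cellN (((((hb m hm).comp ht).mul
        ((continuous_sin_modePhase L m).comp (continuous_apply 0))).mul hφc).mul
        ((hΘ.comp ht).pow 2)) L⟩
  have hP : ∫ X in cellN (N + 1) L, (∑ m ∈ S,
      (a m (vecTail X) * Real.cos (2 * Real.pi / L * ∑ i, (m i : ℝ) * X 0 i) +
        b m (vecTail X) * Real.sin (2 * Real.pi / L * ∑ i, (m i : ℝ) * X 0 i))) * φ X *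
          Θ (vecTail X) ^ 2 =
      ∑ m ∈ S, ((∫ Z in cellN N L, a m Z * A m Z * Θ Z ^ 2) +
        ∫ Z in cellN N L, b m Z * B m Z * Θ Z ^ 2) := by
    have hpt : ∀ X : Config (N + 1), (∑ m ∈ S,
        (a m (vecTail X) * Real.cos (2 * Real.pi / L * ∑ i, (m i : ℝ) * X 0 i) +
          b m (vecTail X) * Real.sin (2 * Real.pi / L * ∑ i, (m i : ℝ) * X 0 i))) * φ X *
            Θ (vecTail X) ^ 2 =
        ∑ m ∈ S, (a m (vecTail X) * Real.cos (2 * Real.pi / L * ∑ i, (m i : ℝ) * X 0 i) * φ X *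
            Θ (vecTail X) ^ 2 +
          b m (vecTail X) * Real.sin (2 * Real.pi / L * ∑ i, (m i : ℝ) * X 0 i) * φ X *
            Θ (vecTail X) ^ 2) := fun X => by
      rw [Finset.sum_mul, Finset.sum_mul]
      exact Finset.sum_congr rfl fun m _ => by ring
    simp_rw [hpt]
    rw [integral_finsetSum]
    · refine Finset.sum_congr rfl fun m hm => ?_
      rw [integral_add (hI m hm).1 (hI m hm).2,
        setIntegral_cellN_succ_taggedMode hΘ (ha m hm) (continuous_cos_modePhase L m) hφc,
        setIntegral_cellN_succ_taggedMode hΘ (hb m hm) (continuous_sin_modePhase L m) hφc]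
      simp only [← hA, ← hB]
    · intro m hm
      exact (hI m hm).1.add (hI m hm).2
  -- Step 2: the Dirichlet form dominates the bath Dirichlet forms of the mode coefficients
  have hD := dirichletFormW_modeCoeff_le hL hΘ hS hφ A B hA hB
  rw [hP]
  -- Step 3: the real inequality between the variational functionals, with the tests `κ A_m, κ B_m`
  set κ : ℝ := 2 / L ^ 3 with hκ
  have hL3 : 0 ≤ L ^ 3 / 2 := by positivity
  obtain ⟨T, hT⟩ : ∃ T : (Fin 3 → ℤ) → ℝ, ∀ m, T m =
      (2 * (∫ Z in cellN N L, a m Z * (κ • A m) Z * Θ Z ^ 2) -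
          dirichletFormW L Θ (κ • A m) (κ • A m)) +
        (2 * (∫ Z in cellN N L, b m Z * (κ • B m) Z * Θ Z ^ 2) -
          dirichletFormW L Θ (κ • B m) (κ • B m)) := ⟨_, fun _ => rfl⟩
  have hsum : L ^ 3 / 2 * ∑ m ∈ S, T m =
      2 * (∑ m ∈ S, ((∫ Z in cellN N L, a m Z * A m Z * Θ Z ^ 2) +
          ∫ Z in cellN N L, b m Z * B m Z * Θ Z ^ 2)) -
        κ * ∑ m ∈ S, (dirichletFormW L Θ (A m) (A m) + dirichletFormW L Θ (B m) (B m)) := by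
    simp only [hT, integral_mul_smul_mul_sq, dirichletFormW_smul_left, dirichletFormW_smul_right]
    rw [Finset.mul_sum, Finset.mul_sum, Finset.mul_sum, ← Finset.sum_sub_distrib]
    refine Finset.sum_congr rfl fun m _ => ?_
    rw [hκ]
    field_simp
    ring
  -- Step 4: pass to `ℝ≥0∞` and bound each mode by its `H₋₁` norm (`le_hMinusOneSqW`)
  calc ENNReal.ofReal (2 * (∑ m ∈ S, ((∫ Z in cellN N L, a m Z * A m Z * Θ Z ^ 2) +
          ∫ Z in cellN N L, b m Z * B m Z * Θ Z ^ 2)) -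
            dirichletFormW L (fun X : Config (N + 1) => Θ (vecTail X)) φ φ)
      ≤ ENNReal.ofReal (L ^ 3 / 2 * ∑ m ∈ S, T m) :=
        ENNReal.ofReal_le_ofReal (by rw [hsum]; linarith [hD])
    _ = ENNReal.ofReal (L ^ 3 / 2) * ENNReal.ofReal (∑ m ∈ S, T m) := ENNReal.ofReal_mul hL3
    _ ≤ ENNReal.ofReal (L ^ 3 / 2) * ∑ m ∈ S, ENNReal.ofReal (T m) := by
        -- `ofReal` of a finite sum is at most the sum of the `ofReal`s (truncation at `0`)
        gcongr
        have hof : ∀ U : Finset (Fin 3 → ℤ),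
            ENNReal.ofReal (∑ m ∈ U, T m) ≤ ∑ m ∈ U, ENNReal.ofReal (T m) := by
          intro U
          induction U using Finset.induction_on with
          | empty => simp
          | insert m U' hm ih =>
            rw [Finset.sum_insert hm, Finset.sum_insert hm]
            exact ENNReal.ofReal_add_le.trans (add_le_add le_rfl ih)
        exact hof S
    _ ≤ ENNReal.ofReal (L ^ 3 / 2) *
          ∑ m ∈ S, (hMinusOneSqW L Θ (a m) + hMinusOneSqW L Θ (b m)) := by
        gcongr with m hm
        rw [hT]
        exact ENNReal.ofReal_add_le.trans (add_le_add (le_hMinusOneSqW L Θ (a m) ((hAt m).smul κ))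
          (le_hMinusOneSqW L Θ (b m) ((hBt m).smul κ)))

end Summit.AtomisticToContinuum.BoseEinsteinCondensation.Theorems.CorrectorClosure.HealingScaleKacInsertion

end
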